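import Literature.Probability.Percolation.ArmSeparationInnerFrames
import HarnessLib

/-!
# Fence boxes about middle tips of different sides are disjoint

Topic `Literature/Probability/Percolation`; family `crit-perc` / near-critical percolation on `𝕋`.
A brick of the near-critical arm-separation theorem for four arms in the ADJACENT colour
arrangement (P. Nolin, EJP 13 (2008), Thm. 11, `j = 4`, `σ = BBWW` [arXiv 0711.4948: Thm. 10];
the last missing input `hsepAdj` of `Werner2009_lemma63_of_altSeparation_of_adjSeparation`).

In the cross-frame pair step (`TrapPairCross.lean`) the fences of the terms of two different
trapezoids (behind two different sides `io ≠ ic` of `∂Λ_{2M}`, each described in its own frame,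
`frameIso`) must be disjoint as sets of actual sites. Their sites lie in the squares of half-width
`2κ + 1` about the tips `(2M, t)`, and the tips are middle: `-2M + 8κ ≤ t ≤ -8κ` (corner guards).

* `frameIso_tipBox_ne` — two such squares, in the frames of two different sides, have no common
  actual site (`64κ < M`).

Everything here is proved (linear arithmetic on the six explicit frame maps,
`frameIso_apply_formula`); no named facts are introduced.

## References

* P. Nolin, Near-critical percolation in two dimensions, *Electron. J. Probab.* 13 (2008), §4.4
  (arXiv 0711.4948: proof of Thm. 10) [Nolin2008].
-/

namespace Literature.Probability.Percolation

open LatticeModels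

/-- The case `io = 0` of `frameIso_tipBox_ne`. [folklore] -/
theorem frameIso_tipBox_ne_0 {M κ : ℕ} {tO tC : ℤ} (hκ : 1 ≤ κ) (hκM : 64 * κ < M)
    (hto : -(2 * (M : ℤ)) + 8 * κ ≤ tO ∧ tO ≤ -(8 * (κ : ℤ))) (htc : -(2 * (M : ℤ)) + 8 * κ ≤ tC ∧ tC ≤ -(8 * (κ : ℤ)))
    {v w : Site 2}
    (hv : 2 * (M : ℤ) - (2 * κ + 1) ≤ v 0 ∧ v 0 ≤ 2 * M + (2 * κ + 1) ∧ tO - (2 * κ + 1) ≤ v 1 ∧ v 1 ≤ tO + (2 * κ + 1))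
    (hw : 2 * (M : ℤ) - (2 * κ + 1) ≤ w 0 ∧ w 0 ≤ 2 * M + (2 * κ + 1) ∧ tC - (2 * κ + 1) ≤ w 1 ∧ w 1 ≤ tC + (2 * κ + 1))
    {ic : ℕ} (hic : ic < 6) (hne : 0 ≠ ic) (heq : frameIso 0 v = frameIso ic w) : False := by
  have hκ' : (1 : ℤ) ≤ κ := by exact_mod_cast hκ
  have hκM' : 64 * (κ : ℤ) < M := by exact_mod_cast hκM
  obtain ⟨f0, f1, -, -, -, -, -, -, -, -, -, -⟩ := frameIso_apply_formula v
  obtain ⟨g00, g01, g10, g11, g20, g21, g30, g31, g40, g41, g50, g51⟩ := frameIso_apply_formula w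
  have e0 : (frameIso 0 v) 0 = (frameIso ic w) 0 := by rw [heq]
  have e1 : (frameIso 0 v) 1 = (frameIso ic w) 1 := by rw [heq]
  rw [f0] at e0
  rw [f1] at e1
  interval_cases ic
  · exact absurd rfl hne
  · rw [g10] at e0; rw [g11] at e1; omega
  · rw [g20] at e0; rw [g21] at e1; omega
  · rw [g30] at e0; rw [g31] at e1; omega
  · rw [g40] at e0; rw [g41] at e1; omega
  · rw [g50] at e0; rw [g51] at e1; omega

/-- The case `io = 1` of `frameIso_tipBox_ne`. [folklore] -/
theorem frameIso_tipBox_ne_1 {M κ : ℕ} {tO tC : ℤ} (hκ : 1 ≤ κ) (hκM : 64 * κ < M)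
    (hto : -(2 * (M : ℤ)) + 8 * κ ≤ tO ∧ tO ≤ -(8 * (κ : ℤ))) (htc : -(2 * (M : ℤ)) + 8 * κ ≤ tC ∧ tC ≤ -(8 * (κ : ℤ)))
    {v w : Site 2}
    (hv : 2 * (M : ℤ) - (2 * κ + 1) ≤ v 0 ∧ v 0 ≤ 2 * M + (2 * κ + 1) ∧ tO - (2 * κ + 1) ≤ v 1 ∧ v 1 ≤ tO + (2 * κ + 1))
    (hw : 2 * (M : ℤ) - (2 * κ + 1) ≤ w 0 ∧ w 0 ≤ 2 * M + (2 * κ + 1) ∧ tC - (2 * κ + 1) ≤ w 1 ∧ w 1 ≤ tC + (2 * κ + 1))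
    {ic : ℕ} (hic : ic < 6) (hne : 1 ≠ ic) (heq : frameIso 1 v = frameIso ic w) : False := by
  have hκ' : (1 : ℤ) ≤ κ := by exact_mod_cast hκ
  have hκM' : 64 * (κ : ℤ) < M := by exact_mod_cast hκM
  obtain ⟨-, -, f0, f1, -, -, -, -, -, -, -, -⟩ := frameIso_apply_formula v
  obtain ⟨g00, g01, g10, g11, g20, g21, g30, g31, g40, g41, g50, g51⟩ := frameIso_apply_formula w
  have e0 : (frameIso 1 v) 0 = (frameIso ic w) 0 := by rw [heq]
  have e1 : (frameIso 1 v) 1 = (frameIso ic w) 1 := by rw [heq]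
  rw [f0] at e0
  rw [f1] at e1
  interval_cases ic
  · rw [g00] at e0; rw [g01] at e1; omega
  · exact absurd rfl hne
  · rw [g20] at e0; rw [g21] at e1; omega
  · rw [g30] at e0; rw [g31] at e1; omega
  · rw [g40] at e0; rw [g41] at e1; omega
  · rw [g50] at e0; rw [g51] at e1; omega

/-- The case `io = 2` of `frameIso_tipBox_ne`. [folklore] -/
theorem frameIso_tipBox_ne_2 {M κ : ℕ} {tO tC : ℤ} (hκ : 1 ≤ κ) (hκM : 64 * κ < M)
    (hto : -(2 * (M : ℤ)) + 8 * κ ≤ tO ∧ tO ≤ -(8 * (κ : ℤ))) (htc : -(2 * (M : ℤ)) + 8 * κ ≤ tC ∧ tC ≤ -(8 * (κ : ℤ)))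
    {v w : Site 2}
    (hv : 2 * (M : ℤ) - (2 * κ + 1) ≤ v 0 ∧ v 0 ≤ 2 * M + (2 * κ + 1) ∧ tO - (2 * κ + 1) ≤ v 1 ∧ v 1 ≤ tO + (2 * κ + 1))
    (hw : 2 * (M : ℤ) - (2 * κ + 1) ≤ w 0 ∧ w 0 ≤ 2 * M + (2 * κ + 1) ∧ tC - (2 * κ + 1) ≤ w 1 ∧ w 1 ≤ tC + (2 * κ + 1))
    {ic : ℕ} (hic : ic < 6) (hne : 2 ≠ ic) (heq : frameIso 2 v = frameIso ic w) : False := by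
  have hκ' : (1 : ℤ) ≤ κ := by exact_mod_cast hκ
  have hκM' : 64 * (κ : ℤ) < M := by exact_mod_cast hκM
  obtain ⟨-, -, -, -, f0, f1, -, -, -, -, -, -⟩ := frameIso_apply_formula v
  obtain ⟨g00, g01, g10, g11, g20, g21, g30, g31, g40, g41, g50, g51⟩ := frameIso_apply_formula w
  have e0 : (frameIso 2 v) 0 = (frameIso ic w) 0 := by rw [heq]
  have e1 : (frameIso 2 v) 1 = (frameIso ic w) 1 := by rw [heq]
  rw [f0] at e0
  rw [f1] at e1
  interval_cases ic
  · rw [g00] at e0; rw [g01] at e1; omega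
  · rw [g10] at e0; rw [g11] at e1; omega
  · exact absurd rfl hne
  · rw [g30] at e0; rw [g31] at e1; omega
  · rw [g40] at e0; rw [g41] at e1; omega
  · rw [g50] at e0; rw [g51] at e1; omega

/-- The case `io = 3` of `frameIso_tipBox_ne`. [folklore] -/
theorem frameIso_tipBox_ne_3 {M κ : ℕ} {tO tC : ℤ} (hκ : 1 ≤ κ) (hκM : 64 * κ < M)
    (hto : -(2 * (M : ℤ)) + 8 * κ ≤ tO ∧ tO ≤ -(8 * (κ : ℤ))) (htc : -(2 * (M : ℤ)) + 8 * κ ≤ tC ∧ tC ≤ -(8 * (κ : ℤ)))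
    {v w : Site 2}
    (hv : 2 * (M : ℤ) - (2 * κ + 1) ≤ v 0 ∧ v 0 ≤ 2 * M + (2 * κ + 1) ∧ tO - (2 * κ + 1) ≤ v 1 ∧ v 1 ≤ tO + (2 * κ + 1))
    (hw : 2 * (M : ℤ) - (2 * κ + 1) ≤ w 0 ∧ w 0 ≤ 2 * M + (2 * κ + 1) ∧ tC - (2 * κ + 1) ≤ w 1 ∧ w 1 ≤ tC + (2 * κ + 1))
    {ic : ℕ} (hic : ic < 6) (hne : 3 ≠ ic) (heq : frameIso 3 v = frameIso ic w) : False := by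
  have hκ' : (1 : ℤ) ≤ κ := by exact_mod_cast hκ
  have hκM' : 64 * (κ : ℤ) < M := by exact_mod_cast hκM
  obtain ⟨-, -, -, -, -, -, f0, f1, -, -, -, -⟩ := frameIso_apply_formula v
  obtain ⟨g00, g01, g10, g11, g20, g21, g30, g31, g40, g41, g50, g51⟩ := frameIso_apply_formula w
  have e0 : (frameIso 3 v) 0 = (frameIso ic w) 0 := by rw [heq]
  have e1 : (frameIso 3 v) 1 = (frameIso ic w) 1 := by rw [heq]
  rw [f0] at e0
  rw [f1] at e1
  interval_cases ic
  · rw [g00] at e0; rw [g01] at e1; omega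
  · rw [g10] at e0; rw [g11] at e1; omega
  · rw [g20] at e0; rw [g21] at e1; omega
  · exact absurd rfl hne
  · rw [g40] at e0; rw [g41] at e1; omega
  · rw [g50] at e0; rw [g51] at e1; omega

/-- The case `io = 4` of `frameIso_tipBox_ne`. [folklore] -/
theorem frameIso_tipBox_ne_4 {M κ : ℕ} {tO tC : ℤ} (hκ : 1 ≤ κ) (hκM : 64 * κ < M)
    (hto : -(2 * (M : ℤ)) + 8 * κ ≤ tO ∧ tO ≤ -(8 * (κ : ℤ))) (htc : -(2 * (M : ℤ)) + 8 * κ ≤ tC ∧ tC ≤ -(8 * (κ : ℤ)))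
    {v w : Site 2}
    (hv : 2 * (M : ℤ) - (2 * κ + 1) ≤ v 0 ∧ v 0 ≤ 2 * M + (2 * κ + 1) ∧ tO - (2 * κ + 1) ≤ v 1 ∧ v 1 ≤ tO + (2 * κ + 1))
    (hw : 2 * (M : ℤ) - (2 * κ + 1) ≤ w 0 ∧ w 0 ≤ 2 * M + (2 * κ + 1) ∧ tC - (2 * κ + 1) ≤ w 1 ∧ w 1 ≤ tC + (2 * κ + 1))
    {ic : ℕ} (hic : ic < 6) (hne : 4 ≠ ic) (heq : frameIso 4 v = frameIso ic w) : False := by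
  have hκ' : (1 : ℤ) ≤ κ := by exact_mod_cast hκ
  have hκM' : 64 * (κ : ℤ) < M := by exact_mod_cast hκM
  obtain ⟨-, -, -, -, -, -, -, -, f0, f1, -, -⟩ := frameIso_apply_formula v
  obtain ⟨g00, g01, g10, g11, g20, g21, g30, g31, g40, g41, g50, g51⟩ := frameIso_apply_formula w
  have e0 : (frameIso 4 v) 0 = (frameIso ic w) 0 := by rw [heq]
  have e1 : (frameIso 4 v) 1 = (frameIso ic w) 1 := by rw [heq]
  rw [f0] at e0
  rw [f1] at e1
  interval_cases ic
  · rw [g00] at e0; rw [g01] at e1; omega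
  · rw [g10] at e0; rw [g11] at e1; omega
  · rw [g20] at e0; rw [g21] at e1; omega
  · rw [g30] at e0; rw [g31] at e1; omega
  · exact absurd rfl hne
  · rw [g50] at e0; rw [g51] at e1; omega

/-- The case `io = 5` of `frameIso_tipBox_ne`. [folklore] -/
theorem frameIso_tipBox_ne_5 {M κ : ℕ} {tO tC : ℤ} (hκ : 1 ≤ κ) (hκM : 64 * κ < M)
    (hto : -(2 * (M : ℤ)) + 8 * κ ≤ tO ∧ tO ≤ -(8 * (κ : ℤ))) (htc : -(2 * (M : ℤ)) + 8 * κ ≤ tC ∧ tC ≤ -(8 * (κ : ℤ)))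
    {v w : Site 2}
    (hv : 2 * (M : ℤ) - (2 * κ + 1) ≤ v 0 ∧ v 0 ≤ 2 * M + (2 * κ + 1) ∧ tO - (2 * κ + 1) ≤ v 1 ∧ v 1 ≤ tO + (2 * κ + 1))
    (hw : 2 * (M : ℤ) - (2 * κ + 1) ≤ w 0 ∧ w 0 ≤ 2 * M + (2 * κ + 1) ∧ tC - (2 * κ + 1) ≤ w 1 ∧ w 1 ≤ tC + (2 * κ + 1))
    {ic : ℕ} (hic : ic < 6) (hne : 5 ≠ ic) (heq : frameIso 5 v = frameIso ic w) : False := by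
  have hκ' : (1 : ℤ) ≤ κ := by exact_mod_cast hκ
  have hκM' : 64 * (κ : ℤ) < M := by exact_mod_cast hκM
  obtain ⟨-, -, -, -, -, -, -, -, -, -, f0, f1⟩ := frameIso_apply_formula v
  obtain ⟨g00, g01, g10, g11, g20, g21, g30, g31, g40, g41, g50, g51⟩ := frameIso_apply_formula w
  have e0 : (frameIso 5 v) 0 = (frameIso ic w) 0 := by rw [heq]
  have e1 : (frameIso 5 v) 1 = (frameIso ic w) 1 := by rw [heq]
  rw [f0] at e0
  rw [f1] at e1
  interval_cases ic
  · rw [g00] at e0; rw [g01] at e1; omega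
  · rw [g10] at e0; rw [g11] at e1; omega
  · rw [g20] at e0; rw [g21] at e1; omega
  · rw [g30] at e0; rw [g31] at e1; omega
  · rw [g40] at e0; rw [g41] at e1; omega
  · exact absurd rfl hne

/-- **Fence boxes about middle tips of different sides are disjoint.** If `v` lies in the square
of half-width `2κ + 1` about `(2M, t_o)` and `w` in that about `(2M, t_c)`, with
`-2M + 8κ ≤ t_o, t_c ≤ -8κ`, `1 ≤ κ`, `64κ < M`, then `frameIso io v ≠ frameIso ic w` for
`io ≠ ic` (`io, ic < 6`). [cite: Nolin2008, §4.4 (arXiv 0711.4948: proof of Thm. 10)] -/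
theorem frameIso_tipBox_ne {M κ : ℕ} {tO tC : ℤ} (hκ : 1 ≤ κ) (hκM : 64 * κ < M)
    (hto : -(2 * (M : ℤ)) + 8 * κ ≤ tO ∧ tO ≤ -(8 * (κ : ℤ))) (htc : -(2 * (M : ℤ)) + 8 * κ ≤ tC ∧ tC ≤ -(8 * (κ : ℤ)))
    {v w : Site 2}
    (hv : 2 * (M : ℤ) - (2 * κ + 1) ≤ v 0 ∧ v 0 ≤ 2 * M + (2 * κ + 1) ∧ tO - (2 * κ + 1) ≤ v 1 ∧ v 1 ≤ tO + (2 * κ + 1))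
    (hw : 2 * (M : ℤ) - (2 * κ + 1) ≤ w 0 ∧ w 0 ≤ 2 * M + (2 * κ + 1) ∧ tC - (2 * κ + 1) ≤ w 1 ∧ w 1 ≤ tC + (2 * κ + 1))
    {io ic : ℕ} (hio : io < 6) (hic : ic < 6) (hne : io ≠ ic) (heq : frameIso io v = frameIso ic w) : False := by
  interval_cases io
  · exact frameIso_tipBox_ne_0 hκ hκM hto htc hv hw hic hne heq
  · exact frameIso_tipBox_ne_1 hκ hκM hto htc hv hw hic hne heq
  · exact frameIso_tipBox_ne_2 hκ hκM hto htc hv hw hic hne heq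
  · exact frameIso_tipBox_ne_3 hκ hκM hto htc hv hw hic hne heq
  · exact frameIso_tipBox_ne_4 hκ hκM hto htc hv hw hic hne heq
  · exact frameIso_tipBox_ne_5 hκ hκM hto htc hv hw hic hne heq

end Literature.Probability.Percolation
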